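import Summits.BirchSwinnertonDyer.BirchSwinnertonDyer.Theorems.EisensteinPrimesResidualCharacterSelmerFiniteOfFact
import Summits.BirchSwinnertonDyer.BirchSwinnertonDyer.Theorems.EisensteinPrimesStrictEqUnramifiedDualTransfer
import Literature.NumberTheory.EllipticCurves.CastellaGrossiLeeSkinner2022.OmegaPartnerCharacterSelmerLambda
import HarnessLib

/-!
# Crux 4 `BSDpOnCellC` (stmt-BirchSwinnertonDyer-19034), line crystal v7 — the NON-SPLIT conjunct of the wall WITHOUT [BR𝟙]:
# p668130'' (`TeichmullerPairUnramifiedAtMult.imprimitiveCount_nonsplit_of_an_of_br_of_pub''`) with its hypothesis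
# `hbr : ∀ p, CharMainConjOnTree p` (Keller–Yin-tagged) REPLACED by the PUBLISHED named fact
# `CastellaGrossiLeeSkinner2022.thm122_charGrDual_torsion_muZero_firstUnit_lambda_eq` (CGLS 2022 Thm. 1.2.2 + Rubin's `λ`-clause + Hida)
# (cell `bsd-eis`, width seat `bsd-line-x2-p2` gen 12; skeleton UNCHANGED, W-79)

WHY. The LEAD's composition (crystal v6/v7 `BSDpOnCellC_of`) feeds its non-split count slot `hcountN` with p668130'', passing
`(fun p _ ↦ stub_wallAlgebraic.1 p)` = [BR𝟙] `X1.KellerYinMuLambdaSplit.CharMainConjOnTree` — a statement claim-tagged because it is ALSO used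
at the anomalous local type `θ|_{G_v̄} = 𝟙`. But the non-split chain applies it exactly once (x2-p2 g9's F12
`CharGrSelmerCorankGeOfFacts.imprimitiveCount_nonsplit_of_an_of_br_of_pub`, step «[BR𝟙] at φ»), at the `p`-UNRAMIFIED member `φ`, whose local type
at `v̄` at a NON-split multiplicative prime is the non-trivial unramified quadratic character `δ ∉ {𝟙, ω}` — the two regime clauses are
already produced there by `CharGrSelmerLambdaRelaxation.charHypotheses_of_not_split` (g10, unconditional). So on the non-split side [BR𝟙] is
INSIDE CGLS Thm. 1.2.2's printed regime, and this seat's §2 fact `thm122_charGrDual_torsion_muZero_firstUnit_lambda_eq` (p688467: binders =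
`CharMainConjOnTree` + the two regime clauses, strict-dual currency, no `[θ|_{G_K} = 𝟙]` term) replaces it BY NAME.

RESULT. `imprimitiveCount_nonsplit_of_an_of_brPrinted_of_pub''` — p668130''s statement VERBATIM except that the binder
`(hbr : ∀ (p : ℕ) [Fact p.Prime], CharMainConjOnTree p)` is REPLACED by `(hbrP : thm122_charGrDual_torsion_muZero_firstUnit_lambda_eq)`;
binder list `hprop125 h263 h5A hlift hlocal h411 h41 h42 h32 hF1 hbrP hω han`. Proof = F12's proof (g9) token for token with: the finiteness
clause `hfact` from `prop14_residualCharacterSelmer_finite_of_fact hprop125` and [LOCp-mult] `hloc` from `teichmullerPair_isUnramifiedAt_or_of_cellC`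
(the two discharges of F13/F14, inlined), and the step «[BR𝟙] at φ» replaced by: `hbrP` at `φ` with the regime clauses `hne1`, `hneω` of
`charHypotheses_of_not_split` ⟹ the property (f.g. ∧ torsion ∧ μ = 0 ∧ ∃ m, FirstUnitCoeffAt L₁ m ∧ λ = m) for every STRICT dual datum ⟹ the
same for the unramified datum `Dφ` by the tree theorems `StrictEqUnramifiedCentral.grSelmer_charModule_eq_unrSelmer` (`φ|_{G_v̄} ≠ 𝟙`) and
`prop_datumDualData_of_forall_grDualData` (as in p688155). Hence for the LEAD (v8/v9, by name):
`hcountN := imprimitiveCount_nonsplit_of_an_of_brPrinted_of_pub'' <10 PUB> hF1 <§2 PUB conjunct> (brOmegaMult_heavy_of_light (BrOmegaMultOfPrint.brOmegaMult_light_of_print <§1 PUB conjunct>)) (han_of_… …)`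
— the NON-SPLIT half of the wall rests on PUBLISHED named facts + the derived analytic sentence [AN-mult] ONLY; [BR𝟙] `stub_wallAlgebraic.1` is
then consumed by the SPLIT chain alone (anomalous type), which is where its claim tag belongs.

HONEST FRAMING: helper theorem only (0 defs, 0 named facts introduced here, 0 sorry); CONDITIONAL on TEN + TWO published named facts
(Greenberg 2016 Props. 2.6.3, 4.1.1; Greenberg 2006 Props. 4.1, 4.2, §5 A, 3.2; CGLS Prop. 1.2.5, Cor. 1.2.6 ×2, Thm. 2.1.2; §2 of
`OmegaPartnerCharacterSelmerLambda`) and on the inline heavy [BRω-mult] / [AN-mult] texts (the former now derivable from §1 of the same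
Literature file via p688155 + p684333); closes no stub by itself; no summit statement / BSD / MC / IMC is proved for any curve; 0 cells /
labels / tiers move.

References: [CastellaGrossiLeeSkinner2022] Thm. 1.2.2, Prop. 1.2.5, Cor. 1.2.6, Thm. 2.1.2, Thms. 2.2.1–2.2.3 with (2.16); [Greenberg2016Selmer]
Props. 2.6.3, 4.1.1; [Greenberg2006] Props. 3.2, 4.1, 4.2, §5 A; [KellerYin2024] §5.1 (b), Lemma 5.1.2 (arXiv:2402.12781v2; shape of the
wall only); [GreenbergVatsal2000] §2; p666110 (F12), p666804 (F13), p668130 (F14), p670160, p688155, p688467.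
-/

set_option autoImplicit false
set_option linter.dupNamespace false -- the summit namespace `…BirchSwinnertonDyer.BirchSwinnertonDyer.Theorems` (Sub = Summit, D-0017) trips it

noncomputable section

open scoped Classical MatrixGroups ModularForm

open CongruenceSubgroup WeierstrassCurve NumberField IsDedekindDomain Field PowerSeries
  Literature.NumberTheory.EllipticCurves Literature.NumberTheory.EllipticCurves.GreenbergSelmer
  Literature.NumberTheory.EllipticCurves.ModularForms Literature.NumberTheory.QuadraticFields
  Literature.NumberTheory.EllipticCurves.Rank1Residual
  Literature.NumberTheory.EllipticCurves.Rank1Residual.Typed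
  Literature.NumberTheory.EllipticCurves.KrizLi2019
  Literature.NumberTheory.EllipticCurves.GreenbergVatsal2000
  Literature.NumberTheory.EllipticCurves.Wuthrich2014
  Literature.NumberTheory.EllipticCurves.SteinWuthrich2013
  Literature.NumberTheory.EllipticCurves.Castella2018Exceptional
  Literature.NumberTheory.EllipticCurves.Castella2018
  Literature.NumberTheory.GaloisRepresentations Literature.NumberTheory.GaloisCohomology
  Literature.NumberTheory.Automorphic
  Literature.NumberTheory.EllipticCurves.CastellaGrossiLeeSkinner2022
  Literature.NumberTheory.IwasawaTheory Literature.NumberTheory.IwasawaTheory.Greenberg2016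
  Literature.NumberTheory.IwasawaTheory.Greenberg2006
  Summit.BirchSwinnertonDyer.Rank1Residual.X11b.AcSelmer
  Summit.BirchSwinnertonDyer.Rank1Residual.X11b.Halves
  Summit.BirchSwinnertonDyer.Rank1Residual.X11b
  Summit.BirchSwinnertonDyer.Rank1Residual Summit.BirchSwinnertonDyer.Rank1Residual.X1
  Summit.BirchSwinnertonDyer.Rank1Residual.X1.KellerYinMuLambdaSplit
  Summit.BirchSwinnertonDyer.Rank1Residual.X2
  Summit.BirchSwinnertonDyer.BirchSwinnertonDyer.Theorems
  Summit.BirchSwinnertonDyer.BirchSwinnertonDyer.Theorems.EisensteinPrimesMuLambda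
open Literature.NumberTheory.EllipticCurves.KellerYin2024

namespace Summit.BirchSwinnertonDyer.BirchSwinnertonDyer.Theorems.CharGrSelmerCorankGeOfFacts

/-- **THE NON-SPLIT CONJUNCT OF THE WALL FROM PRINT + [BRω-mult] + [AN-mult]** — p668130''
(`TeichmullerPairUnramifiedAtMult.imprimitiveCount_nonsplit_of_an_of_br_of_pub''`) with `hbr : ∀ p, CharMainConjOnTree p` REPLACED by the
PUBLISHED named fact `thm122_charGrDual_torsion_muZero_firstUnit_lambda_eq` (CGLS 2022 Thm. 1.2.2 + Rubin's `λ`-clause + Hida's `μ = 0`, the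
`p`-unramified character in the printed regime `φ|_{G_v̄} ∉ {𝟙, ω}`): for every NON-split X2c datum with its heavy telescope, TEN PUB facts
+ CGLS Thm. 2.1.2 (`hF1`) + that fact + the inline heavy [BRω-mult] (`hω`) and [AN-mult] (`han`) give
`m + Σ_{w∈Sf} λ(𝒫_w(f)) ≤ λ(X_ac^{Sf}(E_K[p^∞]))`. Everything else VERBATIM p668130''/F12 (statement, telescope, proof); see the module
docstring for the one changed step. [cite: CastellaGrossiLeeSkinner2022, Thm. 1.2.2 (Rubin, Hida) and proof of Thm. 2.2.3 (λ(𝔛_φ) = λ(𝓛_φ)); Prop. 1.2.5, Cor. 1.2.6, Thm. 2.1.2]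
[cite: KellerYin2024, Lemma 5.1.2 and §5.1 (b) (arXiv:2402.12781v2) (the wall; shape only)] [cite: Greenberg2016Selmer, Props. 2.6.3, 4.1.1]
[cite: Greenberg2006, Props. 3.2, 4.1, 4.2, §5 A] [cite: GreenbergVatsal2000, §2 Prop. (2.4)] -/
theorem imprimitiveCount_nonsplit_of_an_of_brPrinted_of_pub''
    (hprop125 : prop125_characterGrSelmerDual_torsion_muZero_dim) (h263 : prop263_sur_of_crk)
    (h5A : sec5A_localH2_subsingleton_of_LOC1)
    (hlift : cor126_residualCharacter_globalLift) (hlocal : cor126_residualCharacter_localSurjective)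
    (h411 : prop411_selmer_isAlmostDivisible) (h41 : prop41_globalEulerPoincareCorank)
    (h42 : prop42_localEulerPoincareCorank) (h32 : prop32_cohomology_isCofinitelyGenerated)
    (hF1 : thm212_exists_isKatzLFunction)
    (hbrP : thm122_charGrDual_torsion_muZero_firstUnit_lambda_eq)
    (hω :
      (∀ (W : WeierstrassCurve ℚ) [W.IsElliptic] [W.IsGloballyMinimal] (p : ℕ) [Fact p.Prime],
        ∀ (N : ℕ) [NeZero N] (K : Type) [Field K] [NumberField K] (Dt : ModularParametrizationData W N)
          (H : HeegnerDatum N (NumberField.discr K)) (ιK : K →+* ℂ) (P : (W.baseChange K).toAffine.Point),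
          CellC W p → ¬ W.HasSplitMultiplicativeReductionAtPrime p → W.conductorNorm ℤ = N →
          IsImaginaryQuadratic K → NumberField.discr K < -4 → SatisfiesHeegnerHypothesis N K →
          (W.quadraticTwist (NumberField.discr K : ℚ)).entireLFunction 1 ≠ 0 →
          WeierstrassCurve.Affine.Point.map ιK.toRatAlgHom P = heegnerPointComplex Dt H →
          ¬ (p : ℤ) ∣ Dt.c → ¬ IsOfFinAddOrder P →
          Odd (NumberField.discr K) →
          ∀ (κ : ZpExtension K p), κ.IsAnticyclotomic →
            ∀ (γ : Field.absoluteGaloisGroup K) [Fact (κ.IsTopGenerator γ)]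
              (𝔭 : HeightOneSpectrum (𝓞 K)), ((p : ℕ) : 𝓞 K) ∈ 𝔭.asIdeal →
              𝔭.asIdeal.ramificationIdx (𝓞 ℚ) = 1 → 𝔭.asIdeal.inertiaDeg (𝓞 ℚ) = 1 →
              ∀ (𝔭bar : HeightOneSpectrum (𝓞 K)), ((p : ℕ) : 𝓞 K) ∈ 𝔭bar.asIdeal → 𝔭bar ≠ 𝔭 →
                ((Ideal.span {(p : ℤ)}).primesOver (𝓞 K)).ncard = 2 →
              ∀ (ι' : PadicAlgCl p ≃+* ℂ),
                  (∀ (w : InfinitePlace K) (k : 𝓞 K),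
                    k ∈ 𝔭.asIdeal ↔ ‖ι'.symm (w.embedding (k : K))‖ < 1) →
                      ∀ (Φ : AddSubgroup (geomTorsion W (p : ℤ))), IsRationalLine W p Φ →
                      ∀ (θsub θquot : FramedGaloisRep ℚ (padicCoeffIntegers (∅ : Set (PadicAlgCl p))) 1),
                        IsTeichmullerLiftOn (∅ : Set (PadicAlgCl p)) (Φ.map (geomTorsion W (p : ℤ)).subtype) θsub →
                        IsTeichmullerLiftOnQuot (∅ : Set (PadicAlgCl p)) (Φ.map (geomTorsion W (p : ℤ)).subtype)
                          (geomTorsion W (p : ℤ)) θquot →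
                      ∀ (φ ψ : FramedGaloisRep ℚ (padicCoeffIntegers (∅ : Set (PadicAlgCl p))) 1),
                        (φ = θsub ∧ ψ = θquot ∨ φ = θquot ∧ ψ = θsub) →
                        (∀ u : HeightOneSpectrum (𝓞 ℚ), ((p : ℕ) : 𝓞 ℚ) ∈ u.asIdeal → φ.IsUnramifiedAt u) →
                      ∀ (θK : HeckeCharacter K), IsHeckeCharOf ι' (φ.restrictField K) θK →
                      ∀ (Cbar : Finset (HeightOneSpectrum (𝓞 K))), (∀ u ∈ Cbar, ¬ θK.IsUnramifiedAt u) →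
                      ∀ (ΩK' : ℂ) (Ωp' : (unrIntegers p)ˣ) (Lφ : UnrSeries p), ΩK' ≠ 0 →
                        IsKatzLFunction ι' 𝔭 𝔭bar Cbar κ γ θK ΩK' ((Ωp' : unrIntegers p) : ℂ_[p]) Lφ →
                      ∀ nφ : ℕ, FirstUnitCoeffAt Lφ nφ →
                      ∀ (Dψ : DatumDualData κ γ (charModule (∅ : Set (PadicAlgCl p)) (ψ.restrictField K))
                          (Castella2018.AcSelmer.bdpData (charModule (∅ : Set (PadicAlgCl p)) (ψ.restrictField K)) p 𝔭bar)
                          (∅ : Set (HeightOneSpectrum (𝓞 K)))),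
                        Module.Finite (IwasawaAlgebra p) Dψ.X ∧ Module.IsTorsion (IwasawaAlgebra p) Dψ.X ∧
                          muInvariant p Dψ.X = 0 ∧ lambdaInvariant p Dψ.X = nφ))
    (han :
      (∀ (W : WeierstrassCurve ℚ) [W.IsElliptic] [W.IsGloballyMinimal] (p : ℕ) [Fact p.Prime],
        ∀ (N : ℕ) [NeZero N] (K : Type) [Field K] [NumberField K] (Dt : ModularParametrizationData W N)
          (H : HeegnerDatum N (NumberField.discr K)) (ιK : K →+* ℂ) (P : (W.baseChange K).toAffine.Point),
          CellC W p → ¬ W.HasSplitMultiplicativeReductionAtPrime p → W.conductorNorm ℤ = N →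
          IsImaginaryQuadratic K → NumberField.discr K < -4 → SatisfiesHeegnerHypothesis N K →
          (W.quadraticTwist (NumberField.discr K : ℚ)).entireLFunction 1 ≠ 0 →
          WeierstrassCurve.Affine.Point.map ιK.toRatAlgHom P = heegnerPointComplex Dt H →
          ¬ (p : ℤ) ∣ Dt.c → ¬ IsOfFinAddOrder P →
          Odd (NumberField.discr K) →
          ∀ (κ : ZpExtension K p), κ.IsAnticyclotomic →
            ∀ (γ : Field.absoluteGaloisGroup K) [Fact (κ.IsTopGenerator γ)]
              (𝔭 : HeightOneSpectrum (𝓞 K)), ((p : ℕ) : 𝓞 K) ∈ 𝔭.asIdeal →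
              𝔭.asIdeal.ramificationIdx (𝓞 ℚ) = 1 → 𝔭.asIdeal.inertiaDeg (𝓞 ℚ) = 1 →
              ∀ (𝔭bar : HeightOneSpectrum (𝓞 K)), ((p : ℕ) : 𝓞 K) ∈ 𝔭bar.asIdeal → 𝔭bar ≠ 𝔭 →
                ((Ideal.span {(p : ℤ)}).primesOver (𝓞 K)).ncard = 2 →
              ∀ (f : CuspForm (CongruenceSubgroup.Gamma0 N) 2), IsNewformOf W f →
                ∀ (ι' : PadicAlgCl p ≃+* ℂ),
                  (∀ (w : InfinitePlace K) (k : 𝓞 K),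
                    k ∈ 𝔭.asIdeal ↔ ‖ι'.symm (w.embedding (k : K))‖ < 1) →
                  ∀ (ΩK : ℂ) (Ωp : ℂ_[p]) (Q : PowerSeries 𝓞_ℂ_[p]), ΩK ≠ 0 → ‖Ωp‖ = 1 →
                    R1.IsBDPLFunctionInt p ι' 𝔭 κ γ f ΩK Ωp Q →
                      ∀ (Sf : Finset (HeightOneSpectrum (𝓞 K))),
                      (∀ w : HeightOneSpectrum (𝓞 K), w ∈ Sf ↔
                        (((W.conductorNorm ℤ : ℤ) : 𝓞 K) ∈ w.asIdeal ∧ ((p : ℕ) : 𝓞 K) ∉ w.asIdeal)) →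
                      ∀ (Φ : AddSubgroup (geomTorsion W (p : ℤ))), IsRationalLine W p Φ →
                      ∀ (θsub θquot : FramedGaloisRep ℚ (padicCoeffIntegers (∅ : Set (PadicAlgCl p))) 1),
                        IsTeichmullerLiftOn (∅ : Set (PadicAlgCl p)) (Φ.map (geomTorsion W (p : ℤ)).subtype) θsub →
                        IsTeichmullerLiftOnQuot (∅ : Set (PadicAlgCl p)) (Φ.map (geomTorsion W (p : ℤ)).subtype)
                          (geomTorsion W (p : ℤ)) θquot →
                      ∀ (φ ψ : FramedGaloisRep ℚ (padicCoeffIntegers (∅ : Set (PadicAlgCl p))) 1),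
                        (φ = θsub ∧ ψ = θquot ∨ φ = θquot ∧ ψ = θsub) →
                        (∀ u : HeightOneSpectrum (𝓞 ℚ), ((p : ℕ) : 𝓞 ℚ) ∈ u.asIdeal → φ.IsUnramifiedAt u) →
                      ∀ (θK : HeckeCharacter K), IsHeckeCharOf ι' (φ.restrictField K) θK →
                      ∀ (Cbar : Finset (HeightOneSpectrum (𝓞 K))), (∀ u ∈ Cbar, ¬ θK.IsUnramifiedAt u) →
                      ∀ (ΩK' : ℂ) (Ωp' : (unrIntegers p)ˣ) (Lφ : UnrSeries p), ΩK' ≠ 0 →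
                        IsKatzLFunction ι' 𝔭 𝔭bar Cbar κ γ θK ΩK' ((Ωp' : unrIntegers p) : ℂ_[p]) Lφ →
                      ∀ nφ : ℕ, FirstUnitCoeffAt Lφ nφ →
                      ∀ m : ℕ, ‖((PowerSeries.coeff m Q : 𝓞_ℂ_[p]) : ℂ_[p])‖ = 1 →
                        (∀ i < m, ‖((PowerSeries.coeff i Q : 𝓞_ℂ_[p]) : ℂ_[p])‖ < 1) →
                          m + ∑ w ∈ Sf, curveLocalLambda κ (W.baseChange K) w ≤
                            2 * nφ + ∑ w ∈ Sf, (charLocalLambda (∅ : Set (PadicAlgCl p)) κ (θsub.restrictField K) w +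
                              charLocalLambda (∅ : Set (PadicAlgCl p)) κ (θquot.restrictField K) w))) :
    (∀ (W : WeierstrassCurve ℚ) [W.IsElliptic] [W.IsGloballyMinimal] (p : ℕ) [Fact p.Prime],
      ∀ (N : ℕ) [NeZero N] (K : Type) [Field K] [NumberField K] (Dt : ModularParametrizationData W N)
        (H : HeegnerDatum N (NumberField.discr K)) (ιK : K →+* ℂ) (P : (W.baseChange K).toAffine.Point),
        CellC W p → ¬ W.HasSplitMultiplicativeReductionAtPrime p → W.conductorNorm ℤ = N →
        IsImaginaryQuadratic K → NumberField.discr K < -4 → SatisfiesHeegnerHypothesis N K →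
        (W.quadraticTwist (NumberField.discr K : ℚ)).entireLFunction 1 ≠ 0 →
        WeierstrassCurve.Affine.Point.map ιK.toRatAlgHom P = heegnerPointComplex Dt H →
        ¬ (p : ℤ) ∣ Dt.c → ¬ IsOfFinAddOrder P →
        Odd (NumberField.discr K) →
        ∀ (κ : ZpExtension K p), κ.IsAnticyclotomic →
          ∀ (γ : Field.absoluteGaloisGroup K) [Fact (κ.IsTopGenerator γ)]
            (𝔭 : HeightOneSpectrum (𝓞 K)), ((p : ℕ) : 𝓞 K) ∈ 𝔭.asIdeal →
            𝔭.asIdeal.ramificationIdx (𝓞 ℚ) = 1 → 𝔭.asIdeal.inertiaDeg (𝓞 ℚ) = 1 →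
            ∀ (𝔭bar : HeightOneSpectrum (𝓞 K)), ((p : ℕ) : 𝓞 K) ∈ 𝔭bar.asIdeal → 𝔭bar ≠ 𝔭 →
              ((Ideal.span {(p : ℤ)}).primesOver (𝓞 K)).ncard = 2 →
            ∀ (f : CuspForm (CongruenceSubgroup.Gamma0 N) 2), IsNewformOf W f →
              ∀ (ι' : PadicAlgCl p ≃+* ℂ),
                (∀ (w : InfinitePlace K) (k : 𝓞 K),
                  k ∈ 𝔭.asIdeal ↔ ‖ι'.symm (w.embedding (k : K))‖ < 1) →
                ∀ (ΩK : ℂ) (Ωp : ℂ_[p]) (Q : PowerSeries 𝓞_ℂ_[p]), ΩK ≠ 0 → ‖Ωp‖ = 1 →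
                  R1.IsBDPLFunctionInt p ι' 𝔭 κ γ f ΩK Ωp Q →
                    ∀ (Sf : Finset (HeightOneSpectrum (𝓞 K))),
                    (∀ w : HeightOneSpectrum (𝓞 K), w ∈ Sf ↔
                      (((W.conductorNorm ℤ : ℤ) : 𝓞 K) ∈ w.asIdeal ∧ ((p : ℕ) : 𝓞 K) ∉ w.asIdeal)) →
                    ∀ m : ℕ, ‖((PowerSeries.coeff m Q : 𝓞_ℂ_[p]) : ℂ_[p])‖ = 1 →
                      (∀ i < m, ‖((PowerSeries.coeff i Q : 𝓞_ℂ_[p]) : ℂ_[p])‖ < 1) →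
                        m + ∑ w ∈ Sf, curveLocalLambda κ (W.baseChange K) w ≤
                          lambdaInvariant p (XAc (W.baseChange K) p κ 𝔭bar (↑Sf : Set (HeightOneSpectrum (𝓞 K))) γ)) := by
  intro W _ _ p _ N _ K _ _ Dt H ιK P hc hns hN hK hd4 hHN hL hP hcp hPt hodd κ hκ γ _ 𝔭 h𝔭 he1 hf1 𝔭bar h𝔭bar hne hsplit
    f hf ι' hι' ΩK Ωp Q hΩK hΩp hQ Sf hSf m hm hlt
  -- the two hypotheses of F12 that g9 discharged: CGLS Prop. 1.2.5's finiteness clause from its module clause, [LOCp-mult]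
  have hfact : prop14_residualCharacterSelmer_finite := TeichmullerPairUnramifiedAtMult.prop14_residualCharacterSelmer_finite_of_fact hprop125
  have hp2 : 2 < p := by
    have hp' := (Fact.out : p.Prime).two_le
    rcases hp'.lt_or_eq with h | h
    · exact h
    · exact absurd h.symm hc.2.1
  have hred : Red W p := hc.2.2.1
  have hmult : Mult W p := hc.2.2.2
  have hHN' : SatisfiesHeegnerHypothesis (W.conductorNorm ℤ) K := hN ▸ hHN
  have hγ : κ.IsTopGenerator γ := Fact.out
  -- (Heeg) for `p`, `D_K ≠ -3`, the embedding `ι` at the degree-one prime `𝔭`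
  have hHp : SatisfiesHeegnerHypothesis p K := fun q hq hqp ↦ by
    rw [(Nat.prime_dvd_prime_iff_eq hq (Fact.out : p.Prime)).mp hqp]; exact hsplit
  have hd3 : NumberField.discr K ≠ -3 := by omega
  set ι : K →+* ℚ_[p] := X11b.embAt K p 𝔭 h𝔭 he1 hf1 with hιdef
  have hvι : ∀ x : 𝓞 K, x ∈ 𝔭.asIdeal ↔ ‖ι (x : K)‖ < 1 := X11b.mem_asIdeal_iff_norm_embAt_lt_one 𝔭 h𝔭 he1 hf1
  -- the Teichmüller pair over `ℚ` and its restriction to `K`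
  obtain ⟨Φ, hΦ, θs, θq, hs, hq⟩ := exists_teichmullerPair W p hred
  have hpair : IsResidualPairOver (W.baseChange K) p (θs.restrictField K) (θq.restrictField K) :=
    isResidualPairOver_restrictField W p K hΦ hs hq
  have hcardΦ : Nat.card (Φ.map (geomTorsion W (p : ℤ)).subtype) = p := by
    rw [Nat.card_congr (Φ.equivMapOfInjective (geomTorsion W (p : ℤ)).subtype
      (geomTorsion W (p : ℤ)).subtype_injective).toEquiv.symm, hΦ.1]
  have hle : Φ.map (geomTorsion W (p : ℤ)).subtype ≤ geomTorsion W (p : ℤ) := by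
    rintro _ ⟨R, _, rfl⟩
    exact R.2
  -- the character-level binders of both members at the non-split datum
  obtain ⟨-, hchar⟩ := CharGrSelmerLambdaRelaxation.charHypotheses_of_not_split W K 𝔭bar κ Sf hp2 hmult hns hK hHN' hsplit h𝔭bar
    hSf (θs.restrictField K) (θq.restrictField K) hpair
  -- unramified dual data of the two primitive character Selmer groups, and the algebraic identity (TEN PUB facts)
  obtain ⟨D0sub⟩ := nonempty_unrDualData_char (∅ : Set (PadicAlgCl p)) (θs.restrictField K) κ 𝔭bar
    (∅ : Set (HeightOneSpectrum (𝓞 K))) hγ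
  obtain ⟨D0quot⟩ := nonempty_unrDualData_char (∅ : Set (PadicAlgCl p)) (θq.restrictField K) κ 𝔭bar
    (∅ : Set (HeightOneSpectrum (𝓞 K))) hγ
  have h2 := lambdaInvariant_xAc_eq_add_add_sum_unr_of_not_split_of_pub hprop125 h263 h5A hfact hlift hlocal h411 h41 h42 h32 W K 𝔭bar
    κ γ Sf hp2 hmult hns hred hK hHN' hsplit h𝔭 h𝔭bar hne hκ hSf _ _ hpair D0sub D0quot
  -- THE KEY STEP, for either labelling `(φ, ψ)` of the pair with `φ` unramified at `p`
  have key : ∀ (φ ψ : FramedGaloisRep ℚ (padicCoeffIntegers (∅ : Set (PadicAlgCl p))) 1),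
      (φ = θs ∧ ψ = θq ∨ φ = θq ∧ ψ = θs) →
      (∀ u : HeightOneSpectrum (𝓞 ℚ), ((p : ℕ) : 𝓞 ℚ) ∈ u.asIdeal → φ.IsUnramifiedAt u) →
      ∀ (Dφ : DatumDualData κ γ (charModule (∅ : Set (PadicAlgCl p)) (φ.restrictField K))
          (Castella2018.AcSelmer.bdpData (charModule (∅ : Set (PadicAlgCl p)) (φ.restrictField K)) p 𝔭bar) (∅ : Set (HeightOneSpectrum (𝓞 K))))
        (Dψ : DatumDualData κ γ (charModule (∅ : Set (PadicAlgCl p)) (ψ.restrictField K))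
          (Castella2018.AcSelmer.bdpData (charModule (∅ : Set (PadicAlgCl p)) (ψ.restrictField K)) p 𝔭bar) (∅ : Set (HeightOneSpectrum (𝓞 K)))),
      m + ∑ w ∈ Sf, curveLocalLambda κ (W.baseChange K) w ≤
        lambdaInvariant p Dφ.X + lambdaInvariant p Dψ.X +
          ∑ w ∈ Sf, (charLocalLambda (∅ : Set (PadicAlgCl p)) κ (θs.restrictField K) w +
            charLocalLambda (∅ : Set (PadicAlgCl p)) κ (θq.restrictField K) w) := by
    intro φ ψ hφψ hunrp Dφ Dψ
    -- `φ` is Teichmüller, unramified off `N_E`, and non-trivial on `G_K`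
    have hTφ : ∀ σ : absoluteGaloisGroup ℚ, φ σ ^ (p - 1) = 1 := by
      rcases hφψ with ⟨rfl, -⟩ | ⟨rfl, -⟩
      exacts [hs.1, hq.1]
    have hTφK : ∀ σ : absoluteGaloisGroup K, φ.restrictField K σ ^ (p - 1) = 1 := fun σ ↦ hTφ _
    have hunr : ∀ u : HeightOneSpectrum (𝓞 ℚ), ((W.conductorNorm ℤ : ℤ) : 𝓞 ℚ) ∉ u.asIdeal → φ.IsUnramifiedAt u := by
      intro u hu
      by_cases hpu : ((p : ℕ) : 𝓞 ℚ) ∈ u.asIdeal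
      · exact hunrp u hpu
      · rcases hφψ with ⟨rfl, -⟩ | ⟨rfl, -⟩
        · exact isUnramifiedAt_of_isTeichmullerLiftOn W (∅ : Set (PadicAlgCl p)) hcardΦ hle hs
            (hasGoodReductionAt_of_conductorNorm_notMem W u hu) hpu
        · exact isUnramifiedAt_of_isTeichmullerLiftOnQuot W (∅ : Set (PadicAlgCl p)) hcardΦ hq
            (hasGoodReductionAt_of_conductorNorm_notMem W u hu) hpu
    have hφmem : φ.restrictField K = θs.restrictField K ∨ φ.restrictField K = θq.restrictField K := by
      rcases hφψ with ⟨rfl, -⟩ | ⟨rfl, -⟩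
      exacts [Or.inl rfl, Or.inr rfl]
    obtain ⟨-, -, hne1, hneω⟩ := hchar (φ.restrictField K) hφmem
    -- the Hecke character `θ_K` of `φ|_{G_K}` and its Katz frame ([F1b])
    obtain ⟨θK, -, hθK'⟩ := exists_heckeCharacter_of_pow_eq_one (∅ : Set (PadicAlgCl p)) ι' (φ.restrictField K) hTφK
    have hθK : IsHeckeCharOf ι' (φ.restrictField K) θK := hθK'
    obtain ⟨ΩK₁, Ωp₁, L₁, hΩK₁, hL₁⟩ :=
      hF1 p hp2 K hK hHp hodd hd3 ι 𝔭 𝔭bar hvι h𝔭bar hne κ hκ γ ι' hι' φ hTφ (W.conductorNorm ℤ) hHN' hunr hunrp θK hθK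
    have hCbar : ∀ u ∈ (∅ : Finset (HeightOneSpectrum (𝓞 K))), ¬ θK.IsUnramifiedAt u := by simp
    -- [BR𝟙] at `φ` FROM PRINT: `φ|_{G_v̄} = δ ∉ {𝟙, ω}` (non-split), so CGLS Thm. 1.2.2 + Rubin's `λ`-clause apply BY NAME to every
    -- STRICT dual datum; transfer to the unramified datum `Dφ` along `H¹_{𝓕_Gr} = H¹_{𝓕_nr}` (`φ|_{G_v̄} ≠ 𝟙`)
    have hallφ := hbrP p hp2 K hK hHp hodd hd3 ι 𝔭 𝔭bar hvι h𝔭bar hne κ hκ γ ι' hι' φ hTφ (W.conductorNorm ℤ)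
      hHN' hunr hunrp hne1 hneω θK hθK ∅ hCbar ΩK₁ Ωp₁ L₁ hΩK₁ hL₁
    have hbridge := StrictEqUnramifiedCentral.grSelmer_charModule_eq_unrSelmer κ 𝔭bar (∅ : Set (HeightOneSpectrum (𝓞 K)))
      (φ.restrictField K) hTφK hne1
    obtain ⟨-, -, -, nφ, hnφ, hlamφ⟩ :=
      StrictEqUnramifiedCentral.prop_datumDualData_of_forall_grDualData κ 𝔭bar (∅ : Set (HeightOneSpectrum (𝓞 K))) hbridge
        (fun X _ _ ↦ Module.Finite (IwasawaAlgebra p) X ∧ Module.IsTorsion (IwasawaAlgebra p) X ∧ muInvariant p X = 0 ∧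
          ∃ m : ℕ, FirstUnitCoeffAt L₁ m ∧ lambdaInvariant p X = m) hallφ Dφ
    -- [BRω-mult] at `ψ`
    obtain ⟨-, -, -, hlamψ⟩ := hω W p N K Dt H ιK P hc hns hN hK hd4 hHN hL hP hcp hPt hodd κ hκ γ 𝔭 h𝔭 he1 hf1 𝔭bar h𝔭bar hne
      hsplit ι' hι' Φ hΦ θs θq hs hq φ ψ hφψ hunrp θK hθK ∅ hCbar ΩK₁ Ωp₁ L₁ hΩK₁ hL₁ nφ hnφ Dψ
    -- [AN-mult]
    have h1 := han W p N K Dt H ιK P hc hns hN hK hd4 hHN hL hP hcp hPt hodd κ hκ γ 𝔭 h𝔭 he1 hf1 𝔭bar h𝔭bar hne hsplit f hf ι' hι'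
      ΩK Ωp Q hΩK hΩp hQ Sf hSf Φ hΦ θs θq hs hq φ ψ hφψ hunrp θK hθK ∅ hCbar ΩK₁ Ωp₁ L₁ hΩK₁ hL₁ nφ hnφ m hm hlt
    rw [hlamφ, hlamψ]
    omega
  -- pick the member unramified at `p` ([LOCp-mult]) and conclude with the algebraic identity
  rcases TeichmullerPairUnramifiedAtMult.teichmullerPair_isUnramifiedAt_or_of_cellC W p hc hns Φ hΦ θs θq hs hq with hφp | hφp
  · have h1 := key θs θq (Or.inl ⟨rfl, rfl⟩) hφp D0sub D0quot
    rw [h2]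
    exact h1
  · have h1 := key θq θs (Or.inr ⟨rfl, rfl⟩) hφp D0quot D0sub
    rw [h2]
    calc _ ≤ _ := h1
      _ = _ := by ring

end Summit.BirchSwinnertonDyer.BirchSwinnertonDyer.Theorems.CharGrSelmerCorankGeOfFacts

end
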